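import Summits.ResolutionOfSingularities.ResolutionOfSingularities.Theorems.WeightedInvariantIota3TieZeroTransformShape
import Summits.ResolutionOfSingularities.ResolutionOfSingularities.Theorems.WeightedInvariantWeightedConstructionWeightedChartBasicOpen
import HarnessLib

/-!
# No STEEPER integer contact at a fractional-slope curve centre: `f ∉ 𝒥_{(b+1)ν}((y, x); (b+1, 1))`, `b = ⌊r/q⌋`
# (door `HypersurfaceCentreConstruction`, stmt-ResolutionOfSingularities-19897; residual (D-b³-curve-FRAC-TIE-ZERO) of `stub_keyRungGrHomLE_three`)

Topic: `Summits/ResolutionOfSingularities/ResolutionOfSingularities/Theorems`. Helper for the door item `HypersurfaceCentreConstruction`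
(stmt-ResolutionOfSingularities-19897, route `WeightedInvariant`), line `local-engine`, def-free.  Input for the `ε`-analysis at the residual point
`𝔫 = (t⁻¹, z, W)` of `keyRungGrHomLE_three_of_tieDescent_point_curveFracTieZero` (…KeyRungThreeOfDropCurveFracTieZero): there the transform is
`g = c W^ν + t⁻¹ H` (…TieZeroTransformShape) and the order of `g` along the curve `V(t⁻¹, W)` of `B_𝔫` is governed by the `z`-FREE steep ideal
`𝒥_{(b+1)ν}((y, x); (b+1, 1))` — which does NOT contain `f`: by the lex-maximality of the Abramovich–Quek–Schober germ `(y/1, x/1; r, q; rν)` at `S_P`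
an admissible integer datum `(y, x; b+1, 1; (b+1)ν)` would force `(b+1) q ≤ r`, i.e. `b + 1 ≤ ⌊r/q⌋ = b`.

* **`Iota3.not_mem_weightedMonomialIdeal_steeper_of_lexMax`** — `IsLexMaxWeightedCentreGerm (S_P) (f/1) (y/1, x/1) (r, q) (rν)`, `ν ≥ 1` ⟹
  `f ∉ 𝒥_{(r/q+1)ν}((y, x); (r/q+1, 1))` (in `S`; `P` any prime at which the germ is presented).
[OURS · L1 W4.3 · (D-b³-curve-FRAC-TIE) orientation]  Replaces the role of NO printed item; NOT a statement of the manuscript under review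
[claim: Hironaka2017, status: under-review]; candidates stay candidates; AI work, weaker than expert review.  No definition; no axiom.

## References

* D. Abramovich, M. H. Quek, B. Schober, arXiv:2507.01232 (v3, 2026), Thm 1.3 (1), Thm 3.5 (lex-maximality of the invariant). [AbramovichQuekSchober2025]
-/

noncomputable section

open IsLocalRing Literature.AlgebraicGeometry.Resolution
open Summit.ResolutionOfSingularities.ResolutionOfSingularities.Theorems

set_option linter.dupNamespace false -- mandated namespace of this single-conjunct summit

namespace Summit.ResolutionOfSingularities.ResolutionOfSingularities.Cruxes.HypersurfaceCentreConstruction.LocalEngine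

namespace Iota3

/-- **No steeper integer contact at a lex-maximal germ.**  If `(y/1, x/1; r, q; rν)` is the lex-maximal admissible weighted centre germ of `(f/1)` at
`S_P` and `ν ≥ 1`, then `f ∉ 𝒥_{(⌊r/q⌋+1)ν}((y, x); (⌊r/q⌋+1, 1))`: such a membership is an admissible datum with the same first invariant `ν` and second
invariant `(⌊r/q⌋+1)ν > rν/q`, against lex-maximality. [OURS · L1 W4.3] [cite: AbramovichQuekSchober2025, Thm 3.5] -/
theorem not_mem_weightedMonomialIdeal_steeper_of_lexMax {S : Type} [CommRing S] {P : Ideal S} [P.IsPrime] {f x y : S} {q r ν : ℕ}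
    (hν : 1 ≤ ν)
    (hlex : IsLexMaxWeightedCentreGerm (Localization.AtPrime P) (Ideal.span {algebraMap S (Localization.AtPrime P) f})
      ![algebraMap S (Localization.AtPrime P) y, algebraMap S (Localization.AtPrime P) x] ![r, q] (r * ν)) :
    f ∉ weightedMonomialIdeal ![y, x] ![r / q + 1, 1] ((r / q + 1) * ν) := by
  intro hf
  obtain ⟨hspan, hpos, -, -, -, -, -, hmax, -⟩ := hlex
  have hq : 0 < q := by simpa using hpos 1
  -- the competing datum `(y/1, x/1; ⌊r/q⌋+1, 1; (⌊r/q⌋+1)ν)`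
  have hadm : Ideal.span {algebraMap S (Localization.AtPrime P) f} ≤
      weightedMonomialIdeal ![algebraMap S (Localization.AtPrime P) y, algebraMap S (Localization.AtPrime P) x] ![r / q + 1, 1]
        ((r / q + 1) * ν) := by
    rw [Ideal.span_le, Set.singleton_subset_iff, SetLike.mem_coe]
    have h := Ideal.mem_map_of_mem (algebraMap S (Localization.AtPrime P)) hf
    rw [weightedMonomialIdeal_map] at h
    convert h using 2
    funext i; fin_cases i <;> rfl
  have h := hmax ![algebraMap S (Localization.AtPrime P) y, algebraMap S (Localization.AtPrime P) x] ![r / q + 1, 1] ((r / q + 1) * ν)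
    hspan (fun i => by fin_cases i <;> simp) (by simp) (by positivity) hadm
  simp only [Matrix.cons_val_zero, Matrix.cons_val_one] at h
  rcases h with hlt | ⟨-, hle⟩
  · -- `(b+1)ν · r < rν · (b+1)` is absurd
    have heq : (r / q + 1) * ν * r = r * ν * (r / q + 1) := by ring
    rw [heq] at hlt
    exact lt_irrefl _ hlt
  · -- `(b+1)ν · q ≤ rν · 1` forces `(b+1) q ≤ r`, i.e. `b+1 ≤ r/q = b`
    have h1 : (r / q + 1) * q * ν ≤ r * ν := by
      calc (r / q + 1) * q * ν = (r / q + 1) * ν * q := by ring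
        _ ≤ r * ν * 1 := hle
        _ = r * ν := by ring
    have h2 : (r / q + 1) * q ≤ r := Nat.le_of_mul_le_mul_right h1 hν
    have h3 : r / q + 1 ≤ r / q := (Nat.le_div_iff_mul_le hq).mpr h2
    omega

end Iota3

end Summit.ResolutionOfSingularities.ResolutionOfSingularities.Cruxes.HypersurfaceCentreConstruction.LocalEngine

end
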